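import Mathlib.RingTheory.Derivation.Basic
import Mathlib.RingTheory.Polynomial.Basic
import Mathlib.Algebra.Polynomial.Derivative
import Mathlib.Algebra.CharP.Lemmas
import Mathlib.Data.ZMod.Basic
import Mathlib.Data.Nat.Choose.Dvd
import Mathlib.Data.Nat.Prime.Factorial
import Mathlib.Algebra.BigOperators.NatAntidiagonal
import Mathlib.Tactic.Abel
import Mathlib.Tactic.Ring
import HarnessLib

/-!
# Hochschild's formula `(gθ)ᵖ = gᵖ θᵖ + (gθ)ᵖ⁻¹(g)·θ` for a derivation in characteristic `p`
(proofs only)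

Topic `Literature/RingTheory/FormalGroups` (a proofs-only file: theorems, no definition, no
named fact). For a derivation `θ` of a commutative ring `A` of prime characteristic `p` and
`g ∈ A`, the `p`-th iterate of the derivation `gθ` is

  `(gθ)ᵖ(h) = gᵖ · θᵖ(h) + (gθ)ᵖ⁻¹(g) · θ(h)`      (`Derivation` form: `iterate_prime_smul_apply`).

This is Hochschild's Lemma 1 (Trans. AMS 79 (1955), 477–489), the identity that makes the
`p`-th power map `θ ↦ θᵖ` of `Der(A)` compatible with the `A`-module structure (Jacobson,
*Lie algebras*, V.7; Katz, *Nilpotent connections and the monodromy theorem*, Publ. IHÉS 39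
(1970), (5.2)); in the tree it is the engine of the `p`-closedness computation for the formal
leaf `y = exp_{E'}(log_E x)` of Bost's proof of the isogeny theorem for elliptic curves over `ℚ`
(Bost 2001, Prop. 3.9 (2) and Cor. 2.5).

* `iterate_apply_mul_eq_sum_antidiagonal` — Leibniz for iterates,
  `θⁿ(ab) = Σ_{i+j=n} C(n,i) θⁱa · θʲb`;
* `iterate_prime_apply_mul`, `iterate_prime_apply_pow` — in characteristic `p`, `θᵖ` is again a
  derivation (`θᵖ(ab) = a θᵖb + b θᵖa`, `θᵖ(tʲ) = j tʲ⁻¹ θᵖ t`);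
* `exists_coeff_iterate_smul` — over any commutative ring, `(gθ)ⁿ = Σ_{k ≤ n} cₙ,ₖ θᵏ` with
  `cₙ,ₙ = gⁿ`, `cₙ,₀ = 0` (`n ≥ 1`), `cₙ,₁ = (gθ)ⁿ⁻¹(g)`;
* `exists_derivation_polynomial` — `θ` extends to a derivation `Θ` of `A[T]` with `Θ(T) = 1`;
* `iterate_prime_smul_apply` — **Hochschild's formula**.

## The argument

Write `(gθ)ᵖ = Σ_{k=0}^{p} cₖ θᵏ` (`exists_coeff_iterate_smul`); the claim is `cₖ = 0` for
`2 ≤ k ≤ p - 1`. Pass to `A[T]` with the extension `Θ` of `θ` having `Θ(T) = 1`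
(`exists_derivation_polynomial`); the coefficients `c̃ₖ` of `(gΘ)ᵖ` computed in `A[T]` are the
same recursion. The map `E := (gΘ)ᵖ - gᵖΘᵖ - c̃₁Θ = Σ_{k=2}^{p-1} c̃ₖ Θᵏ` is a derivation
(each of the three terms satisfies the Leibniz rule in characteristic `p`), and `E(T) = 0`
because `Θᵏ(T) = 0` for `k ≥ 2`; hence `0 = E(Tʲ) = Σ_{k=2}^{p-1} c̃ₖ · j!/(j-k)! · Tʲ⁻ᵏ` for
every `j`, and taking `j = 2, 3, …, p - 1` in turn gives `j! · c̃ⱼ = 0`, so `c̃ⱼ = 0` (`j!` is a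
unit in characteristic `p > j`). Thus `E = 0` on `A[T]`, in particular on constants, and
`A → A[T]` is injective. (Hochschild's own proof is a direct induction on the coefficients; the
device of testing on powers of an element `T` with `Θ(T) = 1` avoids the closed formula.)

## References

* G. Hochschild, *Simple algebras with purely inseparable splitting fields of exponent 1*,
  Trans. Amer. Math. Soc. 79 (1955), 477–489, Lemma 1. [Hochschild1955]
* N. Jacobson, *Lie Algebras*, Interscience 1962, Ch. V §7 (restricted Lie algebra of derivations).
* J.-B. Bost, *Algebraic leaves of algebraic foliations over number fields*, Publ. Math. IHÉS 93
  (2001), §2.1.1 and Prop. 3.9 (the consumer). [Bost2001AlgebraicLeaves]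
-/

open Polynomial Finset

namespace Literature.RingTheory.FormalGroups

variable {R A : Type*} [CommRing R] [CommRing A] [Algebra R A]

/-! ### Leibniz for iterates -/

/-- **Leibniz rule for iterates of a derivation**: `θⁿ(ab) = Σ_{i+j=n} C(n,i) · θⁱ(a) · θʲ(b)`.
(Same statement and proof as the tree's `Derivation.iterate_apply_mul_eq_sum` in
`AlgebraicGeometry/Resolution/KollarMCInvariantTaylor.lean`, restated here to keep this file's
imports elementary.) [folklore] -/
theorem iterate_apply_mul_eq_sum_antidiagonal (θ : Derivation R A A) (a b : A) (n : ℕ) :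
    θ^[n] (a * b) = ∑ q ∈ antidiagonal n, n.choose q.1 • (θ^[q.1] a * θ^[q.2] b) := by
  induction n with
  | zero => simp
  | succ n ih =>
    have h1 : ∑ q ∈ antidiagonal (n + 1), n.choose q.1 • (θ^[q.1] a * θ^[q.2] b) =
        ∑ q ∈ antidiagonal n, n.choose q.1 • (θ^[q.1] a * θ^[q.2 + 1] b) := by
      rw [Finset.Nat.sum_antidiagonal_succ']
      simp
    have h2 : ∑ q ∈ antidiagonal (n + 1), n.choose q.1 • (θ^[q.1] a * θ^[q.2] b) =
        a * θ^[n + 1] b +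
          ∑ q ∈ antidiagonal n, n.choose (q.1 + 1) • (θ^[q.1 + 1] a * θ^[q.2] b) := by
      rw [Finset.Nat.sum_antidiagonal_succ]
      simp
    have h4 : ∀ q : ℕ × ℕ, θ (n.choose q.1 • (θ^[q.1] a * θ^[q.2] b)) =
        n.choose q.1 • (θ^[q.1 + 1] a * θ^[q.2] b) + n.choose q.1 • (θ^[q.1] a * θ^[q.2 + 1] b) := by
      intro q
      rw [map_nsmul, Derivation.leibniz, smul_eq_mul, smul_eq_mul, Function.iterate_succ_apply',
        Function.iterate_succ_apply', ← smul_add]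
      congr 1
      ring
    calc θ^[n + 1] (a * b)
        = θ (∑ q ∈ antidiagonal n, n.choose q.1 • (θ^[q.1] a * θ^[q.2] b)) := by
          rw [Function.iterate_succ_apply', ih]
      _ = ∑ q ∈ antidiagonal n, n.choose q.1 • (θ^[q.1 + 1] a * θ^[q.2] b) +
            ∑ q ∈ antidiagonal n, n.choose q.1 • (θ^[q.1] a * θ^[q.2 + 1] b) := by
          rw [map_sum]
          simp_rw [h4]
          rw [Finset.sum_add_distrib]
      _ = ∑ q ∈ antidiagonal n, n.choose q.1 • (θ^[q.1 + 1] a * θ^[q.2] b) +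
            (a * θ^[n + 1] b +
              ∑ q ∈ antidiagonal n, n.choose (q.1 + 1) • (θ^[q.1 + 1] a * θ^[q.2] b)) := by
          rw [h1.symm.trans h2]
      _ = a * θ^[n + 1] b +
            ∑ q ∈ antidiagonal n, (n.choose q.1 + n.choose (q.1 + 1)) • (θ^[q.1 + 1] a * θ^[q.2] b) := by
          simp_rw [add_smul, Finset.sum_add_distrib]
          abel
      _ = ∑ q ∈ antidiagonal (n + 1), (n + 1).choose q.1 • (θ^[q.1] a * θ^[q.2] b) := by
          rw [Finset.Nat.sum_antidiagonal_succ]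
          simp only [Nat.choose_zero_right, one_smul, Function.iterate_zero, id_eq,
            Nat.choose_succ_succ']

/-! ### In characteristic `p`, `θᵖ` is a derivation -/

section CharP

variable (p : ℕ) [Fact p.Prime]

/-- In characteristic `p`, a natural number prime to `p` is a unit. [folklore] -/
theorem isUnit_natCast_of_not_dvd' [CharP A p] {a : ℕ} (ha : ¬ p ∣ a) : IsUnit ((a : ℕ) : A) := by
  have hp : p.Prime := Fact.out
  have hcop : a.Coprime p := (Nat.coprime_comm.mp ((Nat.Prime.coprime_iff_not_dvd hp).mpr ha))
  have hu : IsUnit (a : ZMod p) := by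
    rw [← ZMod.coe_unitOfCoprime a hcop]
    exact Units.isUnit _
  have := hu.map (ZMod.castHom (dvd_refl p) A)
  rwa [map_natCast] at this

/-- `j!` is a unit in characteristic `p > j`. [folklore] -/
theorem isUnit_natCast_factorial_of_lt [CharP A p] {j : ℕ} (hj : j < p) :
    IsUnit ((j.factorial : ℕ) : A) :=
  isUnit_natCast_of_not_dvd' p fun h =>
    absurd ((Fact.out : p.Prime).dvd_factorial.mp h) (not_le.mpr hj)

variable [CharP A p]

/-- **`θᵖ` satisfies the Leibniz rule in characteristic `p`**: `θᵖ(ab) = a·θᵖ(b) + b·θᵖ(a)`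
(the middle binomial coefficients `C(p,k)`, `0 < k < p`, vanish). [Jacobson, Lie Algebras V.7]
[folklore] -/
theorem iterate_prime_apply_mul (θ : Derivation R A A) (a b : A) :
    θ^[p] (a * b) = a * θ^[p] b + b * θ^[p] a := by
  have hp : p.Prime := Fact.out
  obtain ⟨q, hq⟩ : ∃ q, p = q + 1 := ⟨p - 1, (Nat.succ_pred_eq_of_pos hp.pos).symm⟩
  rw [iterate_apply_mul_eq_sum_antidiagonal,
    Finset.Nat.sum_antidiagonal_eq_sum_range_succ
      (fun i j => p.choose i • (θ^[i] a * θ^[j] b)) p,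
    sum_range_succ, Nat.choose_self, one_smul, Nat.sub_self, Function.iterate_zero, id_eq]
  rw [hq, sum_range_succ', Nat.choose_zero_right, one_smul, Nat.sub_zero,
    Function.iterate_zero, id_eq, ← hq]
  have hmid : ∑ k ∈ range q, p.choose (k + 1) • (θ^[k + 1] a * θ^[p - (k + 1)] b) = 0 := by
    refine sum_eq_zero fun k hk => ?_
    have hk' : k < q := mem_range.mp hk
    have hdvd : p ∣ p.choose (k + 1) := hp.dvd_choose_self (Nat.succ_ne_zero k) (by omega)
    rw [nsmul_eq_mul, (CharP.cast_eq_zero_iff A p _).mpr hdvd, zero_mul]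
  rw [hmid, zero_add]
  ring

omit [CharP A p] [Fact p.Prime] in
/-- `θⁿ(1) = 0` for `n ≥ 1`. [folklore] -/
theorem iterate_succ_apply_one (θ : Derivation R A A) (n : ℕ) : θ^[n + 1] 1 = 0 := by
  rw [Function.iterate_succ_apply, Derivation.map_one_eq_zero]
  exact Function.iterate_fixed (map_zero θ) n

/-- `θᵖ(tʲ) = j · tʲ⁻¹ · θᵖ(t)` in characteristic `p`. [folklore] -/
theorem iterate_prime_apply_pow (θ : Derivation R A A) (t : A) (j : ℕ) :
    θ^[p] (t ^ j) = (j : A) * t ^ (j - 1) * θ^[p] t := by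
  have hp : p.Prime := Fact.out
  induction j with
  | zero =>
    obtain ⟨q, hq⟩ : ∃ q, p = q + 1 := ⟨p - 1, (Nat.succ_pred_eq_of_pos hp.pos).symm⟩
    rw [pow_zero, Nat.cast_zero, zero_mul, zero_mul, hq, iterate_succ_apply_one]
  | succ j ih =>
    rw [pow_succ, iterate_prime_apply_mul p, ih]
    rcases j with _ | j
    · simp
    · simp only [Nat.add_sub_cancel, Nat.cast_add, Nat.cast_one, pow_succ]
      ring

/-! ### The expansion `(gθ)ⁿ = Σ cₙ,ₖ θᵏ` -/

omit [CharP A p] [Fact p.Prime] in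
/-- **`(gθ)ⁿ = Σ_{k=0}^{n} cₙ,ₖ · θᵏ`** for suitable `cₙ,ₖ ∈ A` with `cₙ,ₙ = gⁿ`, `cₙ,₀ = 0` for
`n ≥ 1`, `cₙ,₁ = (gθ)ⁿ⁻¹(g)` for `n ≥ 1`, and `cₙ,ₖ = 0` for `k > n` (over any commutative
ring; the recursion is `c_{n+1,k} = g(θ(cₙ,ₖ) + c_{n,k-1})`). [cite: Hochschild1955, Lemma 1 (proof)] -/
theorem exists_coeff_iterate_smul (θ : Derivation R A A) (g : A) (n : ℕ) :
    ∃ c : ℕ → A, (∀ h : A, (⇑(g • θ))^[n] h = ∑ k ∈ range (n + 1), c k * θ^[k] h) ∧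
      c n = g ^ n ∧ (1 ≤ n → c 0 = 0) ∧ (1 ≤ n → c 1 = (⇑(g • θ))^[n - 1] g) ∧
      ∀ k, n < k → c k = 0 := by
  induction n with
  | zero =>
    refine ⟨fun k => if k = 0 then 1 else 0, fun h => by simp, by simp, by simp, by simp,
      fun k hk => if_neg (by omega)⟩
  | succ n ih =>
    obtain ⟨c, hc, hcn, hc0, hc1, hcz⟩ := ih
    obtain ⟨c', hc'⟩ : ∃ c' : ℕ → A, ∀ k, c' k = g * (θ (c k) + if k = 0 then 0 else c (k - 1)) :=
      ⟨_, fun k => rfl⟩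
    have hc'0 : c' 0 = g * θ (c 0) := by rw [hc', if_pos rfl, add_zero]
    have hc's : ∀ k, c' (k + 1) = g * (θ (c (k + 1)) + c k) := fun k => by
      rw [hc', if_neg (Nat.succ_ne_zero k), Nat.add_sub_cancel]
    refine ⟨c', fun h => ?_, ?_, ?_, ?_, ?_⟩
    · -- the expansion
      rw [Function.iterate_succ_apply', hc h, Derivation.smul_apply, smul_eq_mul, map_sum]
      have hL : ∀ k, θ (c k * θ^[k] h) = c k * θ^[k + 1] h + θ (c k) * θ^[k] h := by
        intro k
        rw [Derivation.leibniz, smul_eq_mul, smul_eq_mul, Function.iterate_succ_apply']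
        ring
      simp_rw [hL]
      rw [sum_add_distrib, mul_add, mul_sum, mul_sum]
      -- the right-hand side, split at `k = n + 1` and shifted
      have hR : ∑ k ∈ range (n + 1 + 1), c' k * θ^[k] h =
          ∑ k ∈ range (n + 1), g * θ (c k) * θ^[k] h +
            ∑ k ∈ range (n + 1), g * c k * θ^[k + 1] h := by
        have hsplit : ∀ k, c' k * θ^[k] h =
            g * θ (c k) * θ^[k] h + (g * if k = 0 then 0 else c (k - 1)) * θ^[k] h := by
          intro k; rw [hc']; ring
        simp_rw [hsplit]
        rw [sum_add_distrib, sum_range_succ (fun k => g * θ (c k) * θ^[k] h) (n + 1),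
          hcz (n + 1) (Nat.lt_succ_self n), map_zero, mul_zero, zero_mul, add_zero,
          sum_range_succ' _ (n + 1), if_pos rfl, mul_zero, zero_mul, add_zero]
        simp only [Nat.succ_ne_zero, if_false, Nat.add_sub_cancel]
      rw [hR, add_comm]
      congr 1
      · exact sum_congr rfl fun k _ => by ring
      · exact sum_congr rfl fun k _ => by ring
    · -- `c_{n+1,n+1} = g^{n+1}`
      rw [hc's, hcz (n + 1) (Nat.lt_succ_self n), map_zero, zero_add, hcn]
      ring
    · -- `c_{n+1,0} = 0`
      intro _
      rw [hc'0]
      rcases n with _ | n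
      · have : c 0 = 1 := by simpa using hcn
        rw [this, Derivation.map_one_eq_zero, mul_zero]
      · rw [hc0 (by omega), map_zero, mul_zero]
    · -- `c_{n+1,1} = (gθ)ⁿ(g)`
      intro _
      rw [Nat.add_sub_cancel, hc's]
      rcases n with _ | n
      · have h0 : c 0 = 1 := by simpa using hcn
        have h1 : c 1 = 0 := hcz 1 (by omega)
        simp [h0, h1]
      · rw [hc1 (by omega), hc0 (by omega), add_zero, Nat.add_sub_cancel,
          Function.iterate_succ_apply', Derivation.smul_apply, smul_eq_mul]
    · -- vanishing beyond `n + 1`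
      intro k hk
      obtain ⟨m, rfl⟩ : ∃ m, k = m + 1 := ⟨k - 1, by omega⟩
      rw [hc's, hcz (m + 1) (by omega), hcz m (by omega), map_zero, zero_add, mul_zero]

/-! ### Extending `θ` to `A[T]` with `Θ(T) = 1` -/

omit [CharP A p] [Fact p.Prime] in
/-- **`θ` extends to a derivation `Θ` of `A[T]` with `Θ(T) = 1`**: `Θ(Σ aⱼTʲ) = Σ θ(aⱼ)Tʲ +
Σ j aⱼ Tʲ⁻¹` (coefficientwise `θ` plus `d/dT`). [folklore] -/
theorem exists_derivation_polynomial (θ : Derivation R A A) :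
    ∃ Θ : Derivation R A[X] A[X], (∀ a, Θ (C a) = C (θ a)) ∧ Θ X = 1 := by
  classical
  -- coefficientwise `θ`
  let L : A[X] →ₗ[R] A[X] :=
    Polynomial.lsum fun n => ((monomial n : A →ₗ[A] A[X]).restrictScalars R) ∘ₗ θ.toLinearMap
  have hL : ∀ f : A[X], L f = f.sum fun n a => monomial n (θ a) := fun f => by
    simp [L, Polynomial.lsum_apply]
  have hLcoeff : ∀ (f : A[X]) (m : ℕ), (L f).coeff m = θ (f.coeff m) := by
    intro f m
    rw [hL, Polynomial.sum_def, finsetSum_coeff]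
    simp_rw [coeff_monomial]
    rw [sum_ite_eq']
    split_ifs with h
    · rfl
    · rw [notMem_support_iff.mp h, map_zero]
  have hLmul : ∀ f g : A[X], L (f * g) = f * L g + g * L f := by
    intro f g
    ext m
    rw [hLcoeff, coeff_add, coeff_mul, map_sum, coeff_mul, mul_comm g, coeff_mul,
      ← sum_add_distrib]
    refine sum_congr rfl fun x _ => ?_
    rw [Derivation.leibniz, smul_eq_mul, smul_eq_mul, hLcoeff, hLcoeff]
    ring
  let Dlin : A[X] →ₗ[R] A[X] := L + (derivative (R := A)).restrictScalars R
  have hD : ∀ f, Dlin f = L f + derivative f := fun f => rfl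
  refine ⟨Derivation.mk' Dlin fun f g => ?_, fun a => ?_, ?_⟩
  · rw [hD, hD, hD, derivative_mul, hLmul, smul_eq_mul, smul_eq_mul]
    ring
  · rw [Derivation.coe_mk', hD, derivative_C, add_zero]
    ext m
    rw [hLcoeff, coeff_C, coeff_C]
    split_ifs
    · rfl
    · exact map_zero θ
  · rw [Derivation.coe_mk', hD, derivative_X]
    ext m
    rw [coeff_add, hLcoeff, coeff_X, coeff_one]
    by_cases h1 : 1 = m
    · subst h1
      simp
    · rw [if_neg h1, map_zero, zero_add]

/-! ### Hochschild's formula -/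

omit [CharP A p] [Fact p.Prime] in
/-- Iterates of the derivation `gθ` on constants of `A[T]`: `C((gθ)ⁿh) = (C g · Θ)ⁿ(C h)` for an
extension `Θ` of `θ`. [folklore] -/
theorem C_iterate_smul_apply (θ : Derivation R A A) (Θ : Derivation R A[X] A[X])
    (hΘ : ∀ a, Θ (C a) = C (θ a)) (g h : A) (n : ℕ) :
    C ((⇑(g • θ))^[n] h) = (⇑(C g • Θ))^[n] (C h) := by
  induction n with
  | zero => rfl
  | succ n ih =>
    rw [Function.iterate_succ_apply', Function.iterate_succ_apply', ← ih, Derivation.smul_apply,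
      Derivation.smul_apply, smul_eq_mul, smul_eq_mul, hΘ, C_mul]

omit [CharP A p] [Fact p.Prime] in
/-- Iterates on constants: `C(θⁿh) = Θⁿ(C h)` for an extension `Θ` of `θ`. [folklore] -/
theorem C_iterate_apply (θ : Derivation R A A) (Θ : Derivation R A[X] A[X])
    (hΘ : ∀ a, Θ (C a) = C (θ a)) (h : A) (n : ℕ) :
    C (θ^[n] h) = Θ^[n] (C h) := by
  induction n with
  | zero => rfl
  | succ n ih => rw [Function.iterate_succ_apply', Function.iterate_succ_apply', ← ih, hΘ]

omit [CharP A p] [Fact p.Prime] in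
/-- `Θᵏ(Tʲ) = j(j-1)⋯(j-k+1) · Tʲ⁻ᵏ` for a derivation of `A[T]` with `Θ(T) = 1`. [folklore] -/
theorem iterate_apply_X_pow (Θ : Derivation R A[X] A[X]) (hX : Θ X = 1) (j k : ℕ) :
    Θ^[k] (X ^ j) = (j.descFactorial k : A[X]) * X ^ (j - k) := by
  induction k with
  | zero => simp
  | succ k ih =>
    rw [Function.iterate_succ_apply', ih, Derivation.leibniz, Derivation.map_natCast, smul_zero,
      add_zero, smul_eq_mul, Derivation.leibniz_pow, hX, smul_eq_mul, mul_one, nsmul_eq_mul,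
      Nat.descFactorial_succ, Nat.cast_mul, Nat.sub_sub]
    rcases Nat.lt_or_ge k j with hkj | hkj
    · rw [Nat.cast_sub hkj.le]
      ring
    · rw [Nat.sub_eq_zero_of_le hkj, Nat.cast_zero]
      simp

/-- **Hochschild's formula.** For a derivation `θ` of a commutative ring `A` of prime
characteristic `p` and `g, h ∈ A`:
`(gθ)ᵖ(h) = gᵖ · θᵖ(h) + (gθ)ᵖ⁻¹(g) · θ(h)`. (Also Jacobson, *Lie Algebras*, V.7.)
[cite: Hochschild1955, Lemma 1] -/
theorem iterate_prime_smul_apply (θ : Derivation R A A) (g h : A) :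
    (⇑(g • θ))^[p] h = g ^ p * θ^[p] h + (⇑(g • θ))^[p - 1] g * θ h := by
  classical
  have hp : p.Prime := Fact.out
  have hp1 : 1 ≤ p := hp.one_lt.le
  have hp2 : 2 ≤ p := hp.two_le
  obtain ⟨Θ, hΘC, hΘX⟩ := exists_derivation_polynomial θ
  obtain ⟨c, hc, hcp, hc0, hc1, -⟩ := exists_coeff_iterate_smul Θ (C g) p
  -- the defect `E`, a sum over `2 ≤ k ≤ p - 1`
  obtain ⟨E, hE⟩ : ∃ E : A[X] → A[X], ∀ f,
      E f = (⇑(C g • Θ))^[p] f - (C g) ^ p * Θ^[p] f - c 1 * Θ f := ⟨_, fun f => rfl⟩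
  have hfilt : (range p).filter (fun k => ¬ 2 ≤ k) = {0, 1} := by
    ext k
    simp only [mem_filter, mem_range, not_le, mem_insert, mem_singleton]
    omega
  have hEsum : ∀ f, E f = ∑ k ∈ range p with 2 ≤ k, c k * Θ^[k] f := by
    intro f
    have hsplit := sum_filter_add_sum_filter_not (range p) (fun k => 2 ≤ k)
      (fun k => c k * Θ^[k] f)
    rw [hfilt, sum_pair zero_ne_one, hc0 hp1, zero_mul, zero_add, Function.iterate_one] at hsplit
    rw [hE, hc f, sum_range_succ, hcp, ← hsplit]
    ring
  -- `E` satisfies the Leibniz rule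
  have hEmul : ∀ f₁ f₂, E (f₁ * f₂) = f₁ * E f₂ + f₂ * E f₁ := by
    intro f₁ f₂
    simp only [hE, iterate_prime_apply_mul p, Derivation.leibniz, smul_eq_mul]
    ring
  have hE1 : E 1 = 0 := by
    have h11 := hEmul 1 1
    rw [mul_one, one_mul] at h11
    have h' : E 1 + E 1 = E 1 + 0 := by rw [add_zero]; exact h11.symm
    exact add_left_cancel h'
  have hEpow : ∀ j : ℕ, E (X ^ j) = (j : A[X]) * X ^ (j - 1) * E X := by
    intro j
    induction j with
    | zero => rw [pow_zero, hE1, Nat.cast_zero, zero_mul, zero_mul]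
    | succ j ih =>
      rw [pow_succ, hEmul, ih]
      rcases j with _ | j
      · simp
      · simp only [Nat.add_sub_cancel, Nat.cast_add, Nat.cast_one, pow_succ]
        ring
  -- `E(T) = 0`
  have hEX : E X = 0 := by
    rw [hEsum]
    refine sum_eq_zero fun k hk => ?_
    obtain ⟨-, hk2⟩ := mem_filter.mp hk
    obtain ⟨m, rfl⟩ : ∃ m, k = m + 2 := ⟨k - 2, by omega⟩
    rw [Function.iterate_add_apply, Function.iterate_succ_apply', Function.iterate_one, hΘX,
      Derivation.map_one_eq_zero, Function.iterate_fixed (map_zero Θ) m, mul_zero]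
  -- hence all `c k`, `2 ≤ k ≤ p - 1`, vanish
  have hcz : ∀ k, 2 ≤ k → k < p → c k = 0 := by
    intro k
    induction k using Nat.strong_induction_on with
    | _ k ih =>
      intro hk2 hkp
      have hzero : E (X ^ k) = 0 := by rw [hEpow, hEX, mul_zero]
      rw [hEsum] at hzero
      simp_rw [iterate_apply_X_pow Θ hΘX] at hzero
      rw [sum_eq_single_of_mem k (mem_filter.mpr ⟨mem_range.mpr hkp, hk2⟩)] at hzero
      · rw [Nat.descFactorial_self, Nat.sub_self, pow_zero, mul_one] at hzero
        exact (isUnit_natCast_factorial_of_lt (A := A[X]) p hkp).mul_left_eq_zero.mp hzero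
      · intro i hi hik
        obtain ⟨hip, hi2⟩ := mem_filter.mp hi
        rcases Nat.lt_or_gt_of_ne hik with h | h
        · rw [ih i h hi2 (mem_range.mp hip), zero_mul]
        · rw [Nat.descFactorial_eq_zero_iff_lt.mpr h, Nat.cast_zero, zero_mul, mul_zero]
  have hE0 : ∀ f, E f = 0 := fun f => by
    rw [hEsum]
    exact sum_eq_zero fun k hk => by
      obtain ⟨hkp, hk2⟩ := mem_filter.mp hk
      rw [hcz k hk2 (mem_range.mp hkp), zero_mul]
  -- read off the identity on constants
  have key := hE0 (C h)
  rw [hE, sub_eq_zero, sub_eq_iff_eq_add, hc1 hp1] at key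
  apply Polynomial.C_injective
  rw [C_iterate_smul_apply θ Θ hΘC, key, C_add, C_mul, C_mul, C_pow, C_iterate_apply θ Θ hΘC h p,
    C_iterate_smul_apply θ Θ hΘC g g (p - 1), ← hΘC h, add_comm]

end CharP

end Literature.RingTheory.FormalGroups
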